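import Summits.BirchSwinnertonDyer.BirchSwinnertonDyer.Theorems.ManinLocalTwoThreeStevensIntegralityCES
import Summits.BirchSwinnertonDyer.BirchSwinnertonDyer.Theorems.ManinLocalTwoThreeStevensCuspRational
import Summits.BirchSwinnertonDyer.BirchSwinnertonDyer.Theorems.ManinLocalTwoThreeShimuraQuotientRational
import Summits.BirchSwinnertonDyer.BirchSwinnertonDyer.Theorems.ManinLocalTwoThreeShimuraCoverMuThreeHolds
import Summits.BirchSwinnertonDyer.BirchSwinnertonDyer.Theorems.ManinLocalTwoThreeTowerLawConsequences
import Summits.BirchSwinnertonDyer.BirchSwinnertonDyer.Theorems.ManinLocalTwoThreeCuspLiftingHolds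
import Summits.BirchSwinnertonDyer.Rank1Residual.ManinAdditive.ShimuraCoverMuThreeSplit
import Summits.BirchSwinnertonDyer.Rank1Residual.ManinAdditive.ShimuraCuspAnnihilator
import HarnessLib

/-!
# Nine ladder nodes of the cell become UNCONDITIONAL (route `ManinLocalTwoThree`, cruxes C2/C3; cell bsd-f2-manin, prover p2 gen 25)

One-line compositions of the cell's `X_of_<facts>` theorems with the discharges now in the tree — F★
(`StevensGalois.optimalGamma1Parametrization_cusp_rational_holds`), CES
(`StevensIntegrality.exists_optimal_gamma1ParametrizationData_holds`, this seat), E-an-234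
(`ShimuraCoverHolds.shimuraCoverKernelGivesMuThree_holds`), the cusp-lifting discharges (`CuspLifting.*_holds`) — recorded BY NAME:

* E-an-235 `ShimuraCover.shimuraKernelForcesClassTorsion_holds` (a Shimura `p`-kernel puts a rational point of order `p` on a curve of
  the class), E-an-225 `shimuraThreeKernelHasMuThree_holds`, E-es-67♮ `plusIndexPrimeToThreeOfNoMuThree_holds`;
* E-an-67 `shimuraLedgerAtFour_holds`, E-an-66 `totallyBlindGammaOneTransfer_holds` (the `X₁(N)`-ledger at `4 ∣ N`);
* `threeAdicUnitWitnessOfNoRationalThreeTorsion_holds`, `threeAdicUnitWitnessOfNoRationalThreeTorsionOfMuThree_holds` (the `3`-adic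
  unit witness of the Kato-curve road);
* `shimuraPrimePowerDividesCuspZeroOrder_holds`, `shimuraOddPrimeForcesCuspZeroOrder_holds` (cusp-`0` order vs. Shimura quotient).

HONEST FRAMING: bookkeeping only (no new mathematics beyond the cited discharges); C2/C3 remain OPEN as filed (⟸ CDT); Manin's
conjecture and BSD are NOT proved.
-/

set_option autoImplicit false

set_option linter.dupNamespace false

noncomputable section

open Literature.NumberTheory.EllipticCurves Literature.NumberTheory.EllipticCurves.ModularForms
open Summit.BirchSwinnertonDyer.Rank1Residual.ManinAdditive.ShimuraCover
open Summit.BirchSwinnertonDyer.Rank1Residual.ManinAdditive.ShimuraLedger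
open Summit.BirchSwinnertonDyer.Rank1Residual.ManinAdditive.KatoCurve
open Summit.BirchSwinnertonDyer.Rank1Residual.ManinAdditive.HesseOptimality
open Summit.BirchSwinnertonDyer.BirchSwinnertonDyer.Theorems.ManinLocalTwoThree
open Summit.BirchSwinnertonDyer.BirchSwinnertonDyer.Theorems.ManinLocalTwoThree.StevensGalois
  (optimalGamma1Parametrization_cusp_rational_holds)
open Summit.BirchSwinnertonDyer.BirchSwinnertonDyer.Theorems.ManinLocalTwoThree.ShimuraCoverHolds
  (shimuraCoverKernelGivesMuThree_holds)
open Summit.BirchSwinnertonDyer.BirchSwinnertonDyer.Theorems.ManinLocalTwoThree.CuspLifting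
  (cuspZeroAnnihilatesShimuraQuotient_holds shimuraThreeForcesRationalThreeTorsion_holds
    plusIndexPrimeToThreeOfMuThreeNoRationalThreeTorsion_holds)

namespace Summit.BirchSwinnertonDyer.BirchSwinnertonDyer.Theorems.ManinLocalTwoThree.StevensIntegrality

/-- **E-an-235 HOLDS**: a Shimura `p`-kernel of a lattice-optimal datum forces a rational point of order `p` on some curve of the class
(Stevens' curve), unconditionally (F★ and CES are theorems). [cite: Vatsal2005, Rem. 1.8] [cite: ConradEdixhovenStein2003, Thm. 1.1.3] -/
theorem shimuraKernelForcesClassTorsion_holds : ShimuraKernelForcesClassTorsion :=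
  shimuraKernelForcesClassTorsion_of_cuspRational optimalGamma1Parametrization_cusp_rational_holds
    exists_optimal_gamma1ParametrizationData_holds

/-- **E-an-225 HOLDS**: a Shimura `3`-kernel of a lattice-optimal minimal datum gives `μ₃ ⊂ W` (F★, CES, E-an-234 are theorems).
[cite: Vatsal2005, Rem. 1.8] [cite: ConradEdixhovenStein2003, §6.1.2 and §6.2] -/
theorem shimuraThreeKernelHasMuThree_holds : ShimuraThreeKernelHasMuThree :=
  shimuraThreeKernelHasMuThree_of_cover optimalGamma1Parametrization_cusp_rational_holds
    exists_optimal_gamma1ParametrizationData_holds shimuraCoverKernelGivesMuThree_holds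

/-- **E-es-67♮ HOLDS**: no `μ₃` ⟹ the plus-index is prime to `3`. [cite: Vatsal2005, Rem. 1.8] -/
theorem plusIndexPrimeToThreeOfNoMuThree_holds : PlusIndexPrimeToThreeOfNoMuThree :=
  plusIndexPrimeToThreeOfNoMuThree_of_cover optimalGamma1Parametrization_cusp_rational_holds
    exists_optimal_gamma1ParametrizationData_holds shimuraCoverKernelGivesMuThree_holds

/-- **E-an-67 HOLDS** (the `X₁(N)`-ledger at `4 ∣ N`: `|c₀| = |c₁|`, or doubling with a non-blind rational `2`-torsion point),
unconditionally (F★ is a theorem). [cite: Stevens1989, §2] [cite: ConradEdixhovenStein2003, §6.1.2 and §6.2] -/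
theorem shimuraLedgerAtFour_holds : ShimuraLedgerAtFour :=
  shimuraLedgerAtFour_of_cusp_rational optimalGamma1Parametrization_cusp_rational_holds

/-- **E-an-66 HOLDS** (all rational `2`-torsion blind ⟹ `|c₀| = |c₁|` at `4 ∣ N`), unconditionally. [cite: Stevens1989, §2] -/
theorem totallyBlindGammaOneTransfer_holds : TotallyBlindGammaOneTransfer :=
  totallyBlindGammaOneTransfer_of_cusp_rational optimalGamma1Parametrization_cusp_rational_holds

/-- **The `3`-adic unit witness off rational `3`-torsion HOLDS** (Kato-curve road; ⟸ `shimuraThreeForcesRationalThreeTorsion_holds`).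
[cite: Vatsal2005, Rem. 1.8] [cite: Stevens1982, Thm. 1.3.1] -/
theorem threeAdicUnitWitnessOfNoRationalThreeTorsion_holds : ThreeAdicUnitWitnessOfNoRationalThreeTorsion :=
  threeAdicUnitWitnessOfNoRationalThreeTorsion_of_cuspLifting' shimuraThreeForcesRationalThreeTorsion_holds

/-- **The `3`-adic unit witness off rational `3`-torsion, `μ₃` form, HOLDS** (⟸ `plusIndexPrimeToThreeOfMuThreeNoRationalThreeTorsion_holds`).
[cite: Vatsal2005, Rem. 1.8] -/
theorem threeAdicUnitWitnessOfNoRationalThreeTorsionOfMuThree_holds :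
    ThreeAdicUnitWitnessOfNoRationalThreeTorsionOfMuThree :=
  threeAdicUnitWitness_muThree_of_sharp plusIndexPrimeToThreeOfMuThreeNoRationalThreeTorsion_holds

/-- **A Shimura `ℓ^k`-kernel forces `ℓ^k ∣ ord(cusp 0)` HOLDS** (⟸ `cuspZeroAnnihilatesShimuraQuotient_holds`). [cite: Stevens1982, Thm. 1.3.1] -/
theorem shimuraPrimePowerDividesCuspZeroOrder_holds : ShimuraPrimePowerDividesCuspZeroOrder :=
  shimuraPrimePowerDividesCuspZeroOrder_of_annihilator cuspZeroAnnihilatesShimuraQuotient_holds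

/-- **An odd Shimura `ℓ`-kernel forces `ℓ ∣ ord(cusp 0)` HOLDS** (⟸ `cuspZeroAnnihilatesShimuraQuotient_holds`). [cite: Stevens1982, Thm. 1.3.1] -/
theorem shimuraOddPrimeForcesCuspZeroOrder_holds : ShimuraOddPrimeForcesCuspZeroOrder :=
  shimuraOddPrimeForcesCuspZeroOrder_of_annihilator cuspZeroAnnihilatesShimuraQuotient_holds

end Summit.BirchSwinnertonDyer.BirchSwinnertonDyer.Theorems.ManinLocalTwoThree.StevensIntegrality

end
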